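import Summits.QuantumFields.BalabanUV.Beta.GAN24.CombChargeLevelZeroRowsClosed
import Summits.QuantumFields.BalabanUV.Beta.GAN24.CombForcingPairFormSucc

/-!
# `BalabanUV.Beta.GAN24.CombChargeLevelSuccRowsOfCellTotals` — binder row G-an2-4 ∕ (CONV-C), TRANSFER-III, the (III′) (C)-row's END at row D1's literal of record AFTER gen 53:
# **THE G-an2-4 END ⟸ (b) ∧ (Z)_comb(i+1) ∧ J2_comb(i+1) ∧ (ii⁺) `hXF (l+1)` ∧ (iii) W-an2-1′ — MY (H52) `CombChargeLevelZeroRowsClosed` §3 WITH ITS DISPLAY (i⁺) `hB0 (i+1)` REPLACED BY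
# ITS TWO WORD-LEVEL SUPPLIERS** (this gen's `CombForcingPairFormSucc.pairFormLS_combForcing_succ_an1_of_pairForm` BY NAME at every `i`): (Z)_comb(i+1) — the cell totals of the exit-face
# current of the UNTRANSPORTED comb cubic sector `W_i = (Lc⁴·wE_{i+1}) • e3OfK Lc G_i (𝒯 S̃comb_i)` through `X̃_{i+1}` vanish, all slot ∕ face directions (leaf-01 g87: «only the face-slot
# split remains», l.67669) — and J2_comb(i+1) — the two `E ⊗ E` words over `W_i`, times `Lc⁸·Lc^{2(3+1)}·(−(s_f s_m σ_{i+1})²Lc²)`, are an entrywise antisymmetric pair form (leaf-06's J2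
# `ExchangeESectorLatticeWords.exists_pairForm_eeWords_smul` at the comb data — leaf-01 g87's ROADMAP «3F-REC» ∕ «S3C-REC» chain; OPEN)
# (G-an2-4 ∕ (CONV-C) OWNER `b2b-balaban-gan24-p1`, gen 53; journal [GAN24P1-G53-INTENT-3])

NOT IN PRINT; OUR BOOKKEEPING ([folklore] two compositions BY NAME: H52 §3 ∘ this gen's Z §3; 0 `def`, 0 cited fact, 0 `def … : Prop`, 0 sorry).
HONEST FRAMING (cell contract, verbatim): «discharging `BetaPertH` makes Bałaban's UV stability UNCONDITIONAL — a real constructive-QFT result; it is NOT the continuum limit and NOT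
the Clay problem.»  HONEST DEPENDENCY (verbatim): «continuum YM on T⁴ ⇐ BetaPertH ∧ nine spine estimates (0/9 proved); BetaPertH ⇐ (D1) ∧ (D4) ∧ CAP+tail; G-an2-4 gates asym, D1
and NE2/3/4.»

WHAT (at an1's record of (III′): `Odd Lc`, `2 ≤ Lc`, `2 ≤ N`, `cΛ·Lc⁴ = 2`, `cB = −Lc¹²∕4`; the S-slot rows (b) `hS`∕`hSall`; (Z)_comb `hZs`; J2_comb `hRs`; (ii⁺) `hXFs`; (iii) an2's quartic
reflection law `hlaw` with its letters `γ h R2`): **`exists_allScalesSeq_JsB12CombShSym_an1_of_sRows_cellTotals_eePairForm_forcingCrossedSucc_law`** — road FP's D1 literal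
`∃ κ θ<1, AllScalesSeq (j ↦ secondMoment (TbalOf Lc (JsB12CombShSym hLc N (symTablesAn1S2 3 Lc cΛ) cΛ cB) j) μ ν) κ θ`; **`d1Drift_…`** — row D1's reading (`D1Drift ↔ lim = stepBal Nc Lc`)
from the same rows.  THE LANDING BILL OF THE (III′) (C)-ROW AFTER gen 53: (b) the S-slot rows (road-P2's S-campaign; NOT asked, an2 W-4) ∧ (Z)_comb (leaf-01) ∧ J2_comb (the EE pair
form ∕ value chain at the comb data) ∧ `hXF (l+1)` (the crossed VALUES at levels ≥ 1) ∧ W-an2-1′ (an2).  Asserts NO value of Bałaban's tables; every remaining debt a NAMED hypothesis;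
NEVER «G-an2-4 closed» as (CONV-C); NOT D1, NOT `BetaPertH`, NOT continuum, NOT Clay.  2026-08-27; no existing file touched.
-/

noncomputable section

open Finset
open scoped BigOperators
open Literature.MathematicalPhysics.QuantumFieldTheory
open Literature.MathematicalPhysics.QuantumFieldTheory.Balaban1983to89
open Literature.MathematicalPhysics.QuantumFieldTheory.Balaban1983to89.Beta
open ExpKernelCalculus (MKer shiftK)
open OneStepResolventKernel (Fib LocStencil)
open OneStepKernelFamily (TbalOf D1Drift)
open RemainderConstAllScales (AllScalesSeq)
open BalabanCompositeJets (LocStencil₂)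
open PolarizationSign (reflSign)
open KernelReflection (refK)
open ResolventReflection (bref Φ)
open WilsonVertex2Sym (wsym22)
open SecondOrderResponse (W2SymOfK)
open BalabanStepJetsSucc (mmRead)
open BalabanStepW2 (K3OfK M2Of)
open Summit.QuantumFields.BalabanUV.Beta.TameKernelCalculus (trK)
open Summit.QuantumFields.BalabanUV.Beta.ChartConjugation (conjV conjW)
open Summit.QuantumFields.BalabanUV.Beta.BorderedHessian (diagK sgnK bhK)
open Summit.QuantumFields.BalabanUV.Beta.HessKerDressedUnits (unitK unitS)
open Summit.QuantumFields.BalabanUV.Beta.SecondOrderUnits (unitM unitM₂ unitS₂)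
open Summit.QuantumFields.BalabanUV.Beta.SymShiftedSpread (bhKStepSh)
open Summit.QuantumFields.BalabanUV.Beta.E3ContactGenerator (ctGenM)
open Summit.QuantumFields.BalabanUV.Beta.DshAn1 (Dsh)
open Summit.QuantumFields.BalabanUV.Beta.SpineRooted (T2RecOf)
open Summit.QuantumFields.BalabanUV.Beta.CombChartStepJets (GcombSh ScombOf SpureCombOf)
open Summit.QuantumFields.BalabanUV.Beta.SymSecondOrderTablesAn1 (symTablesAn1S2)
open Summit.QuantumFields.BalabanUV.Beta.CombChartJointEnd (JsB12CombShSym)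
open Summit.QuantumFields.BalabanUV.Beta.GAN24.CombesThomas (sfStep smStep)
open Summit.QuantumFields.BalabanUV.Beta.GAN24.BiStencilZeroMode (Tab zmode)
open Summit.QuantumFields.BalabanUV.Beta.GAN24.CombChartChargeEvenClassRow (zsymLegSymEven_of_crossed_an1)
open Summit.QuantumFields.BalabanUV.Beta.GAN24.CombChartParityOddOfQuarticLaw (zmode_unitS₂_T2RecOf_combChart_an1_add_legSwap_eq_zero_of_law)
open Summit.QuantumFields.BalabanUV.Beta.GAN24.CombChargeConservationRowLegSym (exists_allScalesSeq_JsB12CombShSym_an1_of_sRows_legBondSymConserved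
  d1Drift_JsB12CombShSym_an1_iff_lim_eq_of_sRows_legBondSymConserved)

open AffineAveraging (Site box toSite)
open Summit.QuantumFields.BalabanUV.Beta.GAN24.CombChargeConservationRowAssembled (legBondSym_conserved_of_pairForm_crossed_law_levelZero
  exists_allScalesSeq_JsB12CombShSym_an1_of_sRows_pairForm_crossed_law_levelZero d1Drift_JsB12CombShSym_an1_iff_lim_eq_of_sRows_pairForm_crossed_law_levelZero)
open Summit.QuantumFields.BalabanUV.Beta.GAN24.CombChartChargeTowerCrossed (crossedConserved_iff_forcingCrossed_pin)
open Summit.QuantumFields.BalabanUV.Beta.GAN24.CombChartChargeLevelZeroEvenRow (legBondSymEven_levelZero_of_forcingPairForm_forcingCrossed)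

open AffineAveraging (Site box toSite)
open Summit.QuantumFields.BalabanUV.Beta.GAN24.CombChargeConservationRowForcingSide (exists_allScalesSeq_JsB12CombShSym_an1_of_sRows_pairForm_forcingCrossed_law
  d1Drift_JsB12CombShSym_an1_iff_lim_eq_of_sRows_pairForm_forcingCrossed_law)
open Summit.QuantumFields.BalabanUV.Beta.GAN24.CombChartCrossedLedgerFirstStep (forcingCrossed_levelZero_iff_value_pin crossedConserved_levelZero_iff_forcingValue_pin)
open Summit.QuantumFields.BalabanUV.Beta.GAN24.CombForcingPairFormLevelZero (pairFormLS_combForcing_level0_lit crossed_zmode_combForcing_level0_pin)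

open Summit.QuantumFields.BalabanUV.Beta.SpineRooted (e3OfK)
open OneStepKernelFamily (KInvStep vertexOfK)
open ExpKernelCalculus (comp)
open BalabanStepJetsSucc (wE)
open AveragingContoursRooted (ctrOff)
open Summit.QuantumFields.BalabanUV.Beta.AxialDressingRooted (coDressKBmAt)
open Summit.QuantumFields.BalabanUV.Beta.SymCorrectorKernel (psiKS)
open Summit.QuantumFields.BalabanUV.Beta.SymCorrectorFace (slotPsiS)
open Summit.QuantumFields.BalabanUV.Beta.GAN24.CombChargeLevelZeroRowsClosed (exists_allScalesSeq_JsB12CombShSym_an1_of_sRows_pairFormSucc_forcingCrossedSucc_law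
  d1Drift_JsB12CombShSym_an1_iff_lim_eq_of_sRows_pairFormSucc_forcingCrossedSucc_law)
open Summit.QuantumFields.BalabanUV.Beta.GAN24.CombForcingPairFormSucc (pairFormLS_combForcing_succ_an1_of_pairForm)

namespace Summit.QuantumFields.BalabanUV.Beta.GAN24.CombChargeLevelSuccRowsOfCellTotals

variable {Lc : ℕ} [NeZero Lc]

set_option maxHeartbeats 400000 in
/-- NOT IN PRINT; OUR BOOKKEEPING.  **THE G-an2-4 END AT ROW D1's LITERAL OF RECORD (III′) FROM (b), (Z)_comb AND J2_comb AT THE LEVELS `≥ 1`, (ii⁺) `hXF` AT THE LEVELS `≥ 1` AND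
(iii) W-an2-1′** — MY (H52) §3 with (i⁺) `hB0 (i+1)` supplied by this gen's Z §3 from the two displayed word-level letters (ops-buildfix's heartbeat budget as in H52). -/
theorem exists_allScalesSeq_JsB12CombShSym_an1_of_sRows_cellTotals_eePairForm_forcingCrossedSucc_law (hLc : Odd Lc) (hLc2 : 2 ≤ Lc) {N : ℕ} (hN : 2 ≤ N) {cΛ cB : ℝ} (hΛ : cΛ * (Lc : ℝ) ^ 4 = 2) (hcB : cB = -((Lc : ℝ) ^ 12 / 4))
    {Cs cS θS δS : ℝ}
    (hS : ∀ j, LocStencil (unitS (sfStep Lc j) (smStep 3 Lc j) (ScombOf (symTablesAn1S2 3 Lc cΛ) ((Lc : ℝ) ^ 4) (-((Lc : ℝ) ^ 8 / 2)) cΛ j)) Cs δS)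
    (hSall : ∀ k j, LocStencil (unitS (sfStep Lc (k + j)) (smStep 3 Lc (k + j)) (ScombOf (symTablesAn1S2 3 Lc cΛ) ((Lc : ℝ) ^ 4) (-((Lc : ℝ) ^ 8 / 2)) cΛ (k + j)) -
      unitS (sfStep Lc k) (smStep 3 Lc k) (ScombOf (symTablesAn1S2 3 Lc cΛ) ((Lc : ℝ) ^ 4) (-((Lc : ℝ) ^ 8 / 2)) cΛ k)) (cS * θS ^ k) δS)
    (hδS : 0 < δS) (hθS0 : 0 ≤ θS) (hθS1 : θS < 1)
    -- (i⁺) REPLACED BY ITS TWO SUPPLIERS AT THE LEVELS ≥ 1: (Z)_comb — the cell totals of the exit-face current of the untransported comb cubic sector `W_i` — and J2_comb — the pair form of its two `E ⊗ E` words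
    (hZs : ∀ (i : ℕ) (κ₀ γ b : Fin (3 + 1)), ∑ r' ∈ box (3 + 1) Lc, ∑' uw : Site (3 + 1) × Site (3 + 1), (if uw.2 γ % (Lc : ℤ) = (Lc : ℤ) - 1 then (1 : ℝ) else 0) *
        vertexOfK (unitK (sfStep Lc (i + 1)) (smStep 3 Lc (i + 1)) (coDressKBmAt (toSite (ctrOff (3 + 1) Lc)) Lc (KInvStep (d := 3) Lc (i + 1)))) Lc (unitS (sfStep Lc (i + 1)) (smStep 3 Lc (i + 1)) (fun κ t => ((Lc : ℝ) ^ 4 * wE 3 Lc (i + 1)) • e3OfK Lc (coDressKBmAt (toSite (ctrOff (3 + 1) Lc)) Lc (KInvStep (d := 3) Lc i))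
              (fun κ u => comp (comp (trK (psiKS (ctrOff (3 + 1) Lc) Lc)) (slotPsiS (ctrOff (3 + 1) Lc) Lc (ScombOf (symTablesAn1S2 3 Lc cΛ) ((Lc : ℝ) ^ 4) (-((Lc : ℝ) ^ 8 / 2)) cΛ i) κ u)) (psiKS (ctrOff (3 + 1) Lc) Lc)) κ t)) κ₀ uw.1 (toSite r') uw.2 (Sum.inl b) (Sum.inl γ) = 0)
    (hRs : ∀ i : ℕ, ∃ R : Fin (3 + 1) → Fin (3 + 1) → Fin (3 + 1) → Fin (3 + 1) → ℝ,
      (∀ a b c e : Fin (3 + 1), R b a c e = -R a b c e) ∧ (∀ a b c e : Fin (3 + 1), R a b e c = -R a b c e) ∧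
      ∀ κ κ' κ₁ κ₂ : Fin (3 + 1),
        ((Lc : ℝ) ^ 8 * (Lc : ℝ) ^ (2 * (3 + 1))) * (-((sfStep Lc (i + 1) * smStep 3 Lc (i + 1) * ((((Lc ^ (i + 1 + 1) : ℕ) : ℝ)) ^ (3 + 1 + 1))⁻¹) * (sfStep Lc (i + 1) * smStep 3 Lc (i + 1) * ((((Lc ^ (i + 1 + 1) : ℕ) : ℝ)) ^ (3 + 1 + 1))⁻¹)) * ((Lc : ℝ) * (Lc : ℝ))) *
          ((∑ c ∈ box (3 + 1) Lc, ∑' u' : Site (3 + 1), ∑' yw : Site (3 + 1) × Site (3 + 1), (if yw.1 κ₁ % (Lc : ℤ) = (Lc : ℤ) - 1 then (1 : ℝ) else 0) * (if yw.2 κ₂ % (Lc : ℤ) = (Lc : ℤ) - 1 then (1 : ℝ) else 0) *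
        comp (comp (vertexOfK (unitK (sfStep Lc (i + 1)) (smStep 3 Lc (i + 1)) (coDressKBmAt (toSite (ctrOff (3 + 1) Lc)) Lc (KInvStep (d := 3) Lc (i + 1)))) Lc (unitS (sfStep Lc (i + 1)) (smStep 3 Lc (i + 1)) (fun κ t => ((Lc : ℝ) ^ 4 * wE 3 Lc (i + 1)) • e3OfK Lc (coDressKBmAt (toSite (ctrOff (3 + 1) Lc)) Lc (KInvStep (d := 3) Lc i))
              (fun κ u => comp (comp (trK (psiKS (ctrOff (3 + 1) Lc) Lc)) (slotPsiS (ctrOff (3 + 1) Lc) Lc (ScombOf (symTablesAn1S2 3 Lc cΛ) ((Lc : ℝ) ^ 4) (-((Lc : ℝ) ^ 8 / 2)) cΛ i) κ u)) (psiKS (ctrOff (3 + 1) Lc) Lc)) κ t)) κ (toSite c)) (unitK (sfStep Lc (i + 1)) (smStep 3 Lc (i + 1)) (coDressKBmAt (toSite (ctrOff (3 + 1) Lc)) Lc (KInvStep (d := 3) Lc (i + 1)))))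
          (vertexOfK (unitK (sfStep Lc (i + 1)) (smStep 3 Lc (i + 1)) (coDressKBmAt (toSite (ctrOff (3 + 1) Lc)) Lc (KInvStep (d := 3) Lc (i + 1)))) Lc (unitS (sfStep Lc (i + 1)) (smStep 3 Lc (i + 1)) (fun κ t => ((Lc : ℝ) ^ 4 * wE 3 Lc (i + 1)) • e3OfK Lc (coDressKBmAt (toSite (ctrOff (3 + 1) Lc)) Lc (KInvStep (d := 3) Lc i))
              (fun κ u => comp (comp (trK (psiKS (ctrOff (3 + 1) Lc) Lc)) (slotPsiS (ctrOff (3 + 1) Lc) Lc (ScombOf (symTablesAn1S2 3 Lc cΛ) ((Lc : ℝ) ^ 4) (-((Lc : ℝ) ^ 8 / 2)) cΛ i) κ u)) (psiKS (ctrOff (3 + 1) Lc) Lc)) κ t)) κ' u') yw.1 yw.2 (Sum.inl κ₁) (Sum.inl κ₂)) +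
            (∑ c ∈ box (3 + 1) Lc, ∑' u' : Site (3 + 1), ∑' yw : Site (3 + 1) × Site (3 + 1), (if yw.1 κ₁ % (Lc : ℤ) = (Lc : ℤ) - 1 then (1 : ℝ) else 0) * (if yw.2 κ₂ % (Lc : ℤ) = (Lc : ℤ) - 1 then (1 : ℝ) else 0) *
        comp (comp (vertexOfK (unitK (sfStep Lc (i + 1)) (smStep 3 Lc (i + 1)) (coDressKBmAt (toSite (ctrOff (3 + 1) Lc)) Lc (KInvStep (d := 3) Lc (i + 1)))) Lc (unitS (sfStep Lc (i + 1)) (smStep 3 Lc (i + 1)) (fun κ t => ((Lc : ℝ) ^ 4 * wE 3 Lc (i + 1)) • e3OfK Lc (coDressKBmAt (toSite (ctrOff (3 + 1) Lc)) Lc (KInvStep (d := 3) Lc i))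
              (fun κ u => comp (comp (trK (psiKS (ctrOff (3 + 1) Lc) Lc)) (slotPsiS (ctrOff (3 + 1) Lc) Lc (ScombOf (symTablesAn1S2 3 Lc cΛ) ((Lc : ℝ) ^ 4) (-((Lc : ℝ) ^ 8 / 2)) cΛ i) κ u)) (psiKS (ctrOff (3 + 1) Lc) Lc)) κ t)) κ' u') (unitK (sfStep Lc (i + 1)) (smStep 3 Lc (i + 1)) (coDressKBmAt (toSite (ctrOff (3 + 1) Lc)) Lc (KInvStep (d := 3) Lc (i + 1)))))
          (vertexOfK (unitK (sfStep Lc (i + 1)) (smStep 3 Lc (i + 1)) (coDressKBmAt (toSite (ctrOff (3 + 1) Lc)) Lc (KInvStep (d := 3) Lc (i + 1)))) Lc (unitS (sfStep Lc (i + 1)) (smStep 3 Lc (i + 1)) (fun κ t => ((Lc : ℝ) ^ 4 * wE 3 Lc (i + 1)) • e3OfK Lc (coDressKBmAt (toSite (ctrOff (3 + 1) Lc)) Lc (KInvStep (d := 3) Lc i))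
              (fun κ u => comp (comp (trK (psiKS (ctrOff (3 + 1) Lc) Lc)) (slotPsiS (ctrOff (3 + 1) Lc) Lc (ScombOf (symTablesAn1S2 3 Lc cΛ) ((Lc : ℝ) ^ 4) (-((Lc : ℝ) ^ 8 / 2)) cΛ i) κ u)) (psiKS (ctrOff (3 + 1) Lc) Lc)) κ t)) κ (toSite c)) yw.1 yw.2 (Sum.inl κ₁) (Sum.inl κ₂)))
        = R κ κ₁ κ' κ₂ + R κ' κ₁ κ κ₂)
    -- (ii⁺) THE FORCING-SIDE CROSSED ROW at the levels ≥ 1 (level 0 is §1)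
    (hXFs : ∀ (l : ℕ) (a b : Fin (3 + 1)), a ≠ b →
      (zmode Lc (fun κ u κ' u' => ((Lc : ℝ) ^ 8 * (Lc : ℝ) ^ (2 * (3 + 1))) • mmRead Lc (K3OfK (unitK (sfStep Lc (l + 1)) (smStep 3 Lc (l + 1)) (GcombSh (d := 3) Lc (l + 1))) Lc (unitS (sfStep Lc (l + 1)) (smStep 3 Lc (l + 1)) (SpureCombOf (symTablesAn1S2 3 Lc cΛ) ((Lc : ℝ) ^ 4) (-((Lc : ℝ) ^ 8 / 2)) cΛ (l + 1))) (unitM (sfStep Lc (l + 1)) (smStep 3 Lc (l + 1)) ((symTablesAn1S2 3 Lc cΛ).M (l + 1))) (W2SymOfK (unitK (sfStep Lc (l + 1)) (smStep 3 Lc (l + 1)) (GcombSh (d := 3) Lc (l + 1))) Lc (unitS (sfStep Lc (l + 1)) (smStep 3 Lc (l + 1)) (SpureCombOf (symTablesAn1S2 3 Lc cΛ) ((Lc : ℝ) ^ 4) (-((Lc : ℝ) ^ 8 / 2)) cΛ (l + 1))) (unitM (sfStep Lc (l + 1)) (smStep 3 Lc (l + 1)) ((symTablesAn1S2 3 Lc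 cΛ).M (l + 1))) 0 (unitM₂ (sfStep Lc (l + 1)) (smStep 3 Lc (l + 1)) (M2Of 3 Lc (symTablesAn1S2 3 Lc cΛ).mixFF (l + 1)))) κ u κ' u') + cB • (symTablesAn1S2 3 Lc cΛ).vh₂S κ u κ' u') a b (Sum.inl a) (Sum.inl b)
      + zmode Lc (fun κ u κ' u' => ((Lc : ℝ) ^ 8 * (Lc : ℝ) ^ (2 * (3 + 1))) • mmRead Lc (K3OfK (unitK (sfStep Lc (l + 1)) (smStep 3 Lc (l + 1)) (GcombSh (d := 3) Lc (l + 1))) Lc (unitS (sfStep Lc (l + 1)) (smStep 3 Lc (l + 1)) (SpureCombOf (symTablesAn1S2 3 Lc cΛ) ((Lc : ℝ) ^ 4) (-((Lc : ℝ) ^ 8 / 2)) cΛ (l + 1))) (unitM (sfStep Lc (l + 1)) (smStep 3 Lc (l + 1)) ((symTablesAn1S2 3 Lc cΛ).M (l + 1))) (W2SymOfK (unitK (sfStep Lc (l + 1)) (smStep 3 Lc (l + 1)) (GcombSh (d := 3) Lc (l + 1))) Lc (unitS (sfStep Lc (l + 1)) (smStep 3 Lc (l + 1)) (SpureCombOf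 (symTablesAn1S2 3 Lc cΛ) ((Lc : ℝ) ^ 4) (-((Lc : ℝ) ^ 8 / 2)) cΛ (l + 1))) (unitM (sfStep Lc (l + 1)) (smStep 3 Lc (l + 1)) ((symTablesAn1S2 3 Lc cΛ).M (l + 1))) 0 (unitM₂ (sfStep Lc (l + 1)) (smStep 3 Lc (l + 1)) (M2Of 3 Lc (symTablesAn1S2 3 Lc cΛ).mixFF (l + 1)))) κ u κ' u') + cB • (symTablesAn1S2 3 Lc cΛ).vh₂S κ u κ' u') b a (Sum.inl a) (Sum.inl b)
      + (zmode Lc (fun κ u κ' u' => ((Lc : ℝ) ^ 8 * (Lc : ℝ) ^ (2 * (3 + 1))) • mmRead Lc (K3OfK (unitK (sfStep Lc (l + 1)) (smStep 3 Lc (l + 1)) (GcombSh (d := 3) Lc (l + 1))) Lc (unitS (sfStep Lc (l + 1)) (smStep 3 Lc (l + 1)) (SpureCombOf (symTablesAn1S2 3 Lc cΛ) ((Lc : ℝ) ^ 4) (-((Lc : ℝ) ^ 8 / 2)) cΛ (l + 1))) (unitM (sfStep Lc (l + 1)) (smStep 3 Lc (l + 1)) ((symTablesAn1S2 3 Lc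 cΛ).M (l + 1))) (W2SymOfK (unitK (sfStep Lc (l + 1)) (smStep 3 Lc (l + 1)) (GcombSh (d := 3) Lc (l + 1))) Lc (unitS (sfStep Lc (l + 1)) (smStep 3 Lc (l + 1)) (SpureCombOf (symTablesAn1S2 3 Lc cΛ) ((Lc : ℝ) ^ 4) (-((Lc : ℝ) ^ 8 / 2)) cΛ (l + 1))) (unitM (sfStep Lc (l + 1)) (smStep 3 Lc (l + 1)) ((symTablesAn1S2 3 Lc cΛ).M (l + 1))) 0 (unitM₂ (sfStep Lc (l + 1)) (smStep 3 Lc (l + 1)) (M2Of 3 Lc (symTablesAn1S2 3 Lc cΛ).mixFF (l + 1)))) κ u κ' u') + cB • (symTablesAn1S2 3 Lc cΛ).vh₂S κ u κ' u') a b (Sum.inl b) (Sum.inl a)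
      + zmode Lc (fun κ u κ' u' => ((Lc : ℝ) ^ 8 * (Lc : ℝ) ^ (2 * (3 + 1))) • mmRead Lc (K3OfK (unitK (sfStep Lc (l + 1)) (smStep 3 Lc (l + 1)) (GcombSh (d := 3) Lc (l + 1))) Lc (unitS (sfStep Lc (l + 1)) (smStep 3 Lc (l + 1)) (SpureCombOf (symTablesAn1S2 3 Lc cΛ) ((Lc : ℝ) ^ 4) (-((Lc : ℝ) ^ 8 / 2)) cΛ (l + 1))) (unitM (sfStep Lc (l + 1)) (smStep 3 Lc (l + 1)) ((symTablesAn1S2 3 Lc cΛ).M (l + 1))) (W2SymOfK (unitK (sfStep Lc (l + 1)) (smStep 3 Lc (l + 1)) (GcombSh (d := 3) Lc (l + 1))) Lc (unitS (sfStep Lc (l + 1)) (smStep 3 Lc (l + 1)) (SpureCombOf (symTablesAn1S2 3 Lc cΛ) ((Lc : ℝ) ^ 4) (-((Lc : ℝ) ^ 8 / 2)) cΛ (l + 1))) (unitM (sfStep Lc (l + 1)) (smStep 3 Lc (l + 1)) ((symTablesAn1S2 3 Lc cΛ).M (l + 1))) 0 (unitM₂ (sfStep Lc (l + 1)) (smStep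 3 Lc (l + 1)) (M2Of 3 Lc (symTablesAn1S2 3 Lc cΛ).mixFF (l + 1)))) κ u κ' u') + cB • (symTablesAn1S2 3 Lc cΛ).vh₂S κ u κ' u') b a (Sum.inl b) (Sum.inl a)))
        + ((Lc : ℝ) ^ 4 * ∑ r' ∈ box (3 + 1) Lc, ∑' u' : Site (3 + 1), ∑' x : Site (3 + 1), ∑' z : Site (3 + 1), (if toSite r' a % (Lc : ℤ) = (Lc : ℤ) - 1 ∧ u' b % (Lc : ℤ) = (Lc : ℤ) - 1 ∧ x a % (Lc : ℤ) = (Lc : ℤ) - 1 ∧ z b % (Lc : ℤ) = (Lc : ℤ) - 1 then unitS₂ (sfStep Lc (l + 1)) (smStep 3 Lc (l + 1)) (T2RecOf 3 Lc (GcombSh Lc) (SpureCombOf (symTablesAn1S2 3 Lc cΛ) ((Lc : ℝ) ^ 4) (-((Lc : ℝ) ^ 8 / 2)) cΛ) (symTablesAn1S2 3 Lc cΛ).M ((Lc : ℝ) ^ 8) cB ((8 * (N : ℝ) ^ 2)⁻¹ • wsym22 N) (symTablesAn1S2 3 Lc cΛ).vh₂S (symTablesAn1S2 3 Lc cΛ).mixFF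 (l + 1)) a (toSite r') b u' x z (Sum.inl a) (Sum.inl b) else 0) + (Lc : ℝ) ^ 4 * ∑ r' ∈ box (3 + 1) Lc, ∑' u' : Site (3 + 1), ∑' x : Site (3 + 1), ∑' z : Site (3 + 1), (if toSite r' b % (Lc : ℤ) = (Lc : ℤ) - 1 ∧ u' a % (Lc : ℤ) = (Lc : ℤ) - 1 ∧ x a % (Lc : ℤ) = (Lc : ℤ) - 1 ∧ z b % (Lc : ℤ) = (Lc : ℤ) - 1 then unitS₂ (sfStep Lc (l + 1)) (smStep 3 Lc (l + 1)) (T2RecOf 3 Lc (GcombSh Lc) (SpureCombOf (symTablesAn1S2 3 Lc cΛ) ((Lc : ℝ) ^ 4) (-((Lc : ℝ) ^ 8 / 2)) cΛ) (symTablesAn1S2 3 Lc cΛ).M ((Lc : ℝ) ^ 8) cB ((8 * (N : ℝ) ^ 2)⁻¹ • wsym22 N) (symTablesAn1S2 3 Lc cΛ).vh₂S (symTablesAn1S2 3 Lc cΛ).mixFF (l + 1)) b (toSite r') a u' x z (Sum.inl a) (Sum.inl b) else 0)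
      + ((Lc : ℝ) ^ 4 * ∑ r' ∈ box (3 + 1) Lc, ∑' u' : Site (3 + 1), ∑' x : Site (3 + 1), ∑' z : Site (3 + 1), (if toSite r' a % (Lc : ℤ) = (Lc : ℤ) - 1 ∧ u' b % (Lc : ℤ) = (Lc : ℤ) - 1 ∧ x b % (Lc : ℤ) = (Lc : ℤ) - 1 ∧ z a % (Lc : ℤ) = (Lc : ℤ) - 1 then unitS₂ (sfStep Lc (l + 1)) (smStep 3 Lc (l + 1)) (T2RecOf 3 Lc (GcombSh Lc) (SpureCombOf (symTablesAn1S2 3 Lc cΛ) ((Lc : ℝ) ^ 4) (-((Lc : ℝ) ^ 8 / 2)) cΛ) (symTablesAn1S2 3 Lc cΛ).M ((Lc : ℝ) ^ 8) cB ((8 * (N : ℝ) ^ 2)⁻¹ • wsym22 N) (symTablesAn1S2 3 Lc cΛ).vh₂S (symTablesAn1S2 3 Lc cΛ).mixFF (l + 1)) a (toSite r') b u' x z (Sum.inl b) (Sum.inl a) else 0) + (Lc : ℝ) ^ 4 * ∑ r' ∈ box (3 + 1) Lc, ∑' u' : Site (3 + 1), ∑' x : Site (3 + 1), ∑' z : Site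 (3 + 1), (if toSite r' b % (Lc : ℤ) = (Lc : ℤ) - 1 ∧ u' a % (Lc : ℤ) = (Lc : ℤ) - 1 ∧ x b % (Lc : ℤ) = (Lc : ℤ) - 1 ∧ z a % (Lc : ℤ) = (Lc : ℤ) - 1 then unitS₂ (sfStep Lc (l + 1)) (smStep 3 Lc (l + 1)) (T2RecOf 3 Lc (GcombSh Lc) (SpureCombOf (symTablesAn1S2 3 Lc cΛ) ((Lc : ℝ) ^ 4) (-((Lc : ℝ) ^ 8 / 2)) cΛ) (symTablesAn1S2 3 Lc cΛ).M ((Lc : ℝ) ^ 8) cB ((8 * (N : ℝ) ^ 2)⁻¹ • wsym22 N) (symTablesAn1S2 3 Lc cΛ).vh₂S (symTablesAn1S2 3 Lc cΛ).mixFF (l + 1)) b (toSite r') a u' x z (Sum.inl b) (Sum.inl a) else 0)))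
      = (zmode Lc (unitS₂ (sfStep Lc (l + 1)) (smStep 3 Lc (l + 1)) (T2RecOf 3 Lc (GcombSh Lc) (SpureCombOf (symTablesAn1S2 3 Lc cΛ) ((Lc : ℝ) ^ 4) (-((Lc : ℝ) ^ 8 / 2)) cΛ) (symTablesAn1S2 3 Lc cΛ).M ((Lc : ℝ) ^ 8) cB ((8 * (N : ℝ) ^ 2)⁻¹ • wsym22 N) (symTablesAn1S2 3 Lc cΛ).vh₂S (symTablesAn1S2 3 Lc cΛ).mixFF (l + 1))) a b (Sum.inl a) (Sum.inl b)
      + zmode Lc (unitS₂ (sfStep Lc (l + 1)) (smStep 3 Lc (l + 1)) (T2RecOf 3 Lc (GcombSh Lc) (SpureCombOf (symTablesAn1S2 3 Lc cΛ) ((Lc : ℝ) ^ 4) (-((Lc : ℝ) ^ 8 / 2)) cΛ) (symTablesAn1S2 3 Lc cΛ).M ((Lc : ℝ) ^ 8) cB ((8 * (N : ℝ) ^ 2)⁻¹ • wsym22 N) (symTablesAn1S2 3 Lc cΛ).vh₂S (symTablesAn1S2 3 Lc cΛ).mixFF (l + 1))) b a (Sum.inl a) (Sum.inl b)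
      + (zmode Lc (unitS₂ (sfStep Lc (l + 1)) (smStep 3 Lc (l + 1)) (T2RecOf 3 Lc (GcombSh Lc) (SpureCombOf (symTablesAn1S2 3 Lc cΛ) ((Lc : ℝ) ^ 4) (-((Lc : ℝ) ^ 8 / 2)) cΛ) (symTablesAn1S2 3 Lc cΛ).M ((Lc : ℝ) ^ 8) cB ((8 * (N : ℝ) ^ 2)⁻¹ • wsym22 N) (symTablesAn1S2 3 Lc cΛ).vh₂S (symTablesAn1S2 3 Lc cΛ).mixFF (l + 1))) a b (Sum.inl b) (Sum.inl a)
      + zmode Lc (unitS₂ (sfStep Lc (l + 1)) (smStep 3 Lc (l + 1)) (T2RecOf 3 Lc (GcombSh Lc) (SpureCombOf (symTablesAn1S2 3 Lc cΛ) ((Lc : ℝ) ^ 4) (-((Lc : ℝ) ^ 8 / 2)) cΛ) (symTablesAn1S2 3 Lc cΛ).M ((Lc : ℝ) ^ 8) cB ((8 * (N : ℝ) ^ 2)⁻¹ • wsym22 N) (symTablesAn1S2 3 Lc cΛ).vh₂S (symTablesAn1S2 3 Lc cΛ).mixFF (l + 1))) b a (Sum.inl b) (Sum.inl a))))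
    -- (iii) W-an2-1′: an2's QUARTIC REFLECTION LAW OF THE COMB-CHART MEMBER AT EVERY LEVEL, in comb letters (ASK an2; `SpineRecursiveT2AllComb` proves it from table letters)
    (γ : ℕ → ℝ)
    (h : ℕ → Fin 4 → Fin 4 → (Fin 4 → ℤ) → Fin 4 → (Fin 4 → ℤ) → (Fin 4 → ℤ) → Fib 3 → ℝ)
    (hhL : ∀ (j : ℕ) (α : Fin 4), ∃ C δ : ℝ, 0 < δ ∧ LocStencil₂ (fun κ u κ' u' => diagK (h j α κ u κ' u')) C δ)
    (hh : ∀ (j : ℕ) (α κ : Fin 4) (u : Fin 4 → ℤ) (κ' : Fin 4) (u' : Fin 4 → ℤ), ∃ s : Finset (Fin 4 → ℤ), ∀ x ∉ s, ∀ (β : Fin 4), h j α κ u κ' u' x (Sum.inl β) = 0)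
    (R2 : ℕ → Fin 4 → Fin 4 → (Fin 4 → ℤ) → Fin 4 → (Fin 4 → ℤ) → MKer 4 (Fib 3))
    (hR2c : ∀ (j : ℕ) (α : Fin 4), ∃ C δ : ℝ, 0 < δ ∧ LocStencil₂ (R2 j α) C δ)
    (hR2p : ∀ (j : ℕ) (α : Fin 4) κ u κ' u', trK (R2 j α κ u κ' u') = -sgnK (R2 j α κ u κ' u'))
    (hlaw : ∀ (j : ℕ) (α κ : Fin 4) (u : Fin 4 → ℤ) (κ' : Fin 4) (u' : Fin 4 → ℤ),
      T2RecOf 3 Lc (GcombSh Lc) (SpureCombOf (symTablesAn1S2 3 Lc cΛ) ((Lc : ℝ) ^ 4) (-((Lc : ℝ) ^ 8 / 2)) cΛ) (symTablesAn1S2 3 Lc cΛ).M ((Lc : ℝ) ^ 8) cB ((8 * (N : ℝ) ^ 2)⁻¹ • wsym22 N)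
          (symTablesAn1S2 3 Lc cΛ).vh₂S (symTablesAn1S2 3 Lc cΛ).mixFF j κ (bref α κ u) κ' (bref α κ' u') =
        (reflSign α κ * reflSign α κ') • refK (Φ Lc α)
          (T2RecOf 3 Lc (GcombSh Lc) (SpureCombOf (symTablesAn1S2 3 Lc cΛ) ((Lc : ℝ) ^ 4) (-((Lc : ℝ) ^ 8 / 2)) cΛ) (symTablesAn1S2 3 Lc cΛ).M ((Lc : ℝ) ^ 8) cB ((8 * (N : ℝ) ^ 2)⁻¹ • wsym22 N)
              (symTablesAn1S2 3 Lc cΛ).vh₂S (symTablesAn1S2 3 Lc cΛ).mixFF j κ u κ' u' +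
            conjW (bhKStepSh 3 Lc (Dsh Lc) j)
              (SpureCombOf (symTablesAn1S2 3 Lc cΛ) ((Lc : ℝ) ^ 4) (-((Lc : ℝ) ^ 8 / 2)) cΛ j κ u)
              (SpureCombOf (symTablesAn1S2 3 Lc cΛ) ((Lc : ℝ) ^ 4) (-((Lc : ℝ) ^ 8 / 2)) cΛ j κ' u')
              (diagK fun p a => γ j * ctGenM 3 (bhK Lc + Dsh Lc) α Lc κ u p a) (diagK fun p a => γ j * ctGenM 3 (bhK Lc + Dsh Lc) α Lc κ' u' p a)
              (diagK (h j α κ u κ' u')) +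
            R2 j α κ u κ' u'))
    (μ ν : Fin 4) :
    ∃ κ θ : ℝ, 0 ≤ θ ∧ θ < 1 ∧ AllScalesSeq (fun j => B12Beta.secondMoment (TbalOf Lc (JsB12CombShSym hLc N (symTablesAn1S2 3 Lc cΛ) cΛ cB) j) μ ν) κ θ :=
  exists_allScalesSeq_JsB12CombShSym_an1_of_sRows_pairFormSucc_forcingCrossedSucc_law hLc hLc2 hN hΛ hcB hS hSall hδS hθS0 hθS1
    (fun i => pairFormLS_combForcing_succ_an1_of_pairForm cΛ cB i (hZs i) (hRs i)) hXFs γ h hhL hh R2 hR2c hR2p hlaw μ ν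

set_option maxHeartbeats 400000 in
/-- NOT IN PRINT; OUR BOOKKEEPING.  **ROW D1's READING FROM THE SAME DISPLAYS** (the VALUE `lim β = stepBal Nc Lc` is row D1's and is NOT proved). -/
theorem d1Drift_JsB12CombShSym_an1_iff_lim_eq_of_sRows_cellTotals_eePairForm_forcingCrossedSucc_law (hLc : Odd Lc) (hLc2 : 2 ≤ Lc) {N : ℕ} (hN : 2 ≤ N) {cΛ cB : ℝ} (hΛ : cΛ * (Lc : ℝ) ^ 4 = 2) (hcB : cB = -((Lc : ℝ) ^ 12 / 4))
    {Cs cS θS δS : ℝ}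
    (hS : ∀ j, LocStencil (unitS (sfStep Lc j) (smStep 3 Lc j) (ScombOf (symTablesAn1S2 3 Lc cΛ) ((Lc : ℝ) ^ 4) (-((Lc : ℝ) ^ 8 / 2)) cΛ j)) Cs δS)
    (hSall : ∀ k j, LocStencil (unitS (sfStep Lc (k + j)) (smStep 3 Lc (k + j)) (ScombOf (symTablesAn1S2 3 Lc cΛ) ((Lc : ℝ) ^ 4) (-((Lc : ℝ) ^ 8 / 2)) cΛ (k + j)) -
      unitS (sfStep Lc k) (smStep 3 Lc k) (ScombOf (symTablesAn1S2 3 Lc cΛ) ((Lc : ℝ) ^ 4) (-((Lc : ℝ) ^ 8 / 2)) cΛ k)) (cS * θS ^ k) δS)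
    (hδS : 0 < δS) (hθS0 : 0 ≤ θS) (hθS1 : θS < 1)
    -- (i⁺) REPLACED BY ITS TWO SUPPLIERS AT THE LEVELS ≥ 1: (Z)_comb — the cell totals of the exit-face current of the untransported comb cubic sector `W_i` — and J2_comb — the pair form of its two `E ⊗ E` words
    (hZs : ∀ (i : ℕ) (κ₀ γ b : Fin (3 + 1)), ∑ r' ∈ box (3 + 1) Lc, ∑' uw : Site (3 + 1) × Site (3 + 1), (if uw.2 γ % (Lc : ℤ) = (Lc : ℤ) - 1 then (1 : ℝ) else 0) *
        vertexOfK (unitK (sfStep Lc (i + 1)) (smStep 3 Lc (i + 1)) (coDressKBmAt (toSite (ctrOff (3 + 1) Lc)) Lc (KInvStep (d := 3) Lc (i + 1)))) Lc (unitS (sfStep Lc (i + 1)) (smStep 3 Lc (i + 1)) (fun κ t => ((Lc : ℝ) ^ 4 * wE 3 Lc (i + 1)) • e3OfK Lc (coDressKBmAt (toSite (ctrOff (3 + 1) Lc)) Lc (KInvStep (d := 3) Lc i))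
              (fun κ u => comp (comp (trK (psiKS (ctrOff (3 + 1) Lc) Lc)) (slotPsiS (ctrOff (3 + 1) Lc) Lc (ScombOf (symTablesAn1S2 3 Lc cΛ) ((Lc : ℝ) ^ 4) (-((Lc : ℝ) ^ 8 / 2)) cΛ i) κ u)) (psiKS (ctrOff (3 + 1) Lc) Lc)) κ t)) κ₀ uw.1 (toSite r') uw.2 (Sum.inl b) (Sum.inl γ) = 0)
    (hRs : ∀ i : ℕ, ∃ R : Fin (3 + 1) → Fin (3 + 1) → Fin (3 + 1) → Fin (3 + 1) → ℝ,
      (∀ a b c e : Fin (3 + 1), R b a c e = -R a b c e) ∧ (∀ a b c e : Fin (3 + 1), R a b e c = -R a b c e) ∧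
      ∀ κ κ' κ₁ κ₂ : Fin (3 + 1),
        ((Lc : ℝ) ^ 8 * (Lc : ℝ) ^ (2 * (3 + 1))) * (-((sfStep Lc (i + 1) * smStep 3 Lc (i + 1) * ((((Lc ^ (i + 1 + 1) : ℕ) : ℝ)) ^ (3 + 1 + 1))⁻¹) * (sfStep Lc (i + 1) * smStep 3 Lc (i + 1) * ((((Lc ^ (i + 1 + 1) : ℕ) : ℝ)) ^ (3 + 1 + 1))⁻¹)) * ((Lc : ℝ) * (Lc : ℝ))) *
          ((∑ c ∈ box (3 + 1) Lc, ∑' u' : Site (3 + 1), ∑' yw : Site (3 + 1) × Site (3 + 1), (if yw.1 κ₁ % (Lc : ℤ) = (Lc : ℤ) - 1 then (1 : ℝ) else 0) * (if yw.2 κ₂ % (Lc : ℤ) = (Lc : ℤ) - 1 then (1 : ℝ) else 0) *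
        comp (comp (vertexOfK (unitK (sfStep Lc (i + 1)) (smStep 3 Lc (i + 1)) (coDressKBmAt (toSite (ctrOff (3 + 1) Lc)) Lc (KInvStep (d := 3) Lc (i + 1)))) Lc (unitS (sfStep Lc (i + 1)) (smStep 3 Lc (i + 1)) (fun κ t => ((Lc : ℝ) ^ 4 * wE 3 Lc (i + 1)) • e3OfK Lc (coDressKBmAt (toSite (ctrOff (3 + 1) Lc)) Lc (KInvStep (d := 3) Lc i))
              (fun κ u => comp (comp (trK (psiKS (ctrOff (3 + 1) Lc) Lc)) (slotPsiS (ctrOff (3 + 1) Lc) Lc (ScombOf (symTablesAn1S2 3 Lc cΛ) ((Lc : ℝ) ^ 4) (-((Lc : ℝ) ^ 8 / 2)) cΛ i) κ u)) (psiKS (ctrOff (3 + 1) Lc) Lc)) κ t)) κ (toSite c)) (unitK (sfStep Lc (i + 1)) (smStep 3 Lc (i + 1)) (coDressKBmAt (toSite (ctrOff (3 + 1) Lc)) Lc (KInvStep (d := 3) Lc (i + 1)))))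
          (vertexOfK (unitK (sfStep Lc (i + 1)) (smStep 3 Lc (i + 1)) (coDressKBmAt (toSite (ctrOff (3 + 1) Lc)) Lc (KInvStep (d := 3) Lc (i + 1)))) Lc (unitS (sfStep Lc (i + 1)) (smStep 3 Lc (i + 1)) (fun κ t => ((Lc : ℝ) ^ 4 * wE 3 Lc (i + 1)) • e3OfK Lc (coDressKBmAt (toSite (ctrOff (3 + 1) Lc)) Lc (KInvStep (d := 3) Lc i))
              (fun κ u => comp (comp (trK (psiKS (ctrOff (3 + 1) Lc) Lc)) (slotPsiS (ctrOff (3 + 1) Lc) Lc (ScombOf (symTablesAn1S2 3 Lc cΛ) ((Lc : ℝ) ^ 4) (-((Lc : ℝ) ^ 8 / 2)) cΛ i) κ u)) (psiKS (ctrOff (3 + 1) Lc) Lc)) κ t)) κ' u') yw.1 yw.2 (Sum.inl κ₁) (Sum.inl κ₂)) +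
            (∑ c ∈ box (3 + 1) Lc, ∑' u' : Site (3 + 1), ∑' yw : Site (3 + 1) × Site (3 + 1), (if yw.1 κ₁ % (Lc : ℤ) = (Lc : ℤ) - 1 then (1 : ℝ) else 0) * (if yw.2 κ₂ % (Lc : ℤ) = (Lc : ℤ) - 1 then (1 : ℝ) else 0) *
        comp (comp (vertexOfK (unitK (sfStep Lc (i + 1)) (smStep 3 Lc (i + 1)) (coDressKBmAt (toSite (ctrOff (3 + 1) Lc)) Lc (KInvStep (d := 3) Lc (i + 1)))) Lc (unitS (sfStep Lc (i + 1)) (smStep 3 Lc (i + 1)) (fun κ t => ((Lc : ℝ) ^ 4 * wE 3 Lc (i + 1)) • e3OfK Lc (coDressKBmAt (toSite (ctrOff (3 + 1) Lc)) Lc (KInvStep (d := 3) Lc i))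
              (fun κ u => comp (comp (trK (psiKS (ctrOff (3 + 1) Lc) Lc)) (slotPsiS (ctrOff (3 + 1) Lc) Lc (ScombOf (symTablesAn1S2 3 Lc cΛ) ((Lc : ℝ) ^ 4) (-((Lc : ℝ) ^ 8 / 2)) cΛ i) κ u)) (psiKS (ctrOff (3 + 1) Lc) Lc)) κ t)) κ' u') (unitK (sfStep Lc (i + 1)) (smStep 3 Lc (i + 1)) (coDressKBmAt (toSite (ctrOff (3 + 1) Lc)) Lc (KInvStep (d := 3) Lc (i + 1)))))
          (vertexOfK (unitK (sfStep Lc (i + 1)) (smStep 3 Lc (i + 1)) (coDressKBmAt (toSite (ctrOff (3 + 1) Lc)) Lc (KInvStep (d := 3) Lc (i + 1)))) Lc (unitS (sfStep Lc (i + 1)) (smStep 3 Lc (i + 1)) (fun κ t => ((Lc : ℝ) ^ 4 * wE 3 Lc (i + 1)) • e3OfK Lc (coDressKBmAt (toSite (ctrOff (3 + 1) Lc)) Lc (KInvStep (d := 3) Lc i))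
              (fun κ u => comp (comp (trK (psiKS (ctrOff (3 + 1) Lc) Lc)) (slotPsiS (ctrOff (3 + 1) Lc) Lc (ScombOf (symTablesAn1S2 3 Lc cΛ) ((Lc : ℝ) ^ 4) (-((Lc : ℝ) ^ 8 / 2)) cΛ i) κ u)) (psiKS (ctrOff (3 + 1) Lc) Lc)) κ t)) κ (toSite c)) yw.1 yw.2 (Sum.inl κ₁) (Sum.inl κ₂)))
        = R κ κ₁ κ' κ₂ + R κ' κ₁ κ κ₂)
    -- (ii⁺)
    (hXFs : ∀ (l : ℕ) (a b : Fin (3 + 1)), a ≠ b →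
      (zmode Lc (fun κ u κ' u' => ((Lc : ℝ) ^ 8 * (Lc : ℝ) ^ (2 * (3 + 1))) • mmRead Lc (K3OfK (unitK (sfStep Lc (l + 1)) (smStep 3 Lc (l + 1)) (GcombSh (d := 3) Lc (l + 1))) Lc (unitS (sfStep Lc (l + 1)) (smStep 3 Lc (l + 1)) (SpureCombOf (symTablesAn1S2 3 Lc cΛ) ((Lc : ℝ) ^ 4) (-((Lc : ℝ) ^ 8 / 2)) cΛ (l + 1))) (unitM (sfStep Lc (l + 1)) (smStep 3 Lc (l + 1)) ((symTablesAn1S2 3 Lc cΛ).M (l + 1))) (W2SymOfK (unitK (sfStep Lc (l + 1)) (smStep 3 Lc (l + 1)) (GcombSh (d := 3) Lc (l + 1))) Lc (unitS (sfStep Lc (l + 1)) (smStep 3 Lc (l + 1)) (SpureCombOf (symTablesAn1S2 3 Lc cΛ) ((Lc : ℝ) ^ 4) (-((Lc : ℝ) ^ 8 / 2)) cΛ (l + 1))) (unitM (sfStep Lc (l + 1)) (smStep 3 Lc (l + 1)) ((symTablesAn1S2 3 Lc cΛ).M (l + 1))) 0 (unitM₂ (sfStep Lc (l + 1)) (smStep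 3 Lc (l + 1)) (M2Of 3 Lc (symTablesAn1S2 3 Lc cΛ).mixFF (l + 1)))) κ u κ' u') + cB • (symTablesAn1S2 3 Lc cΛ).vh₂S κ u κ' u') a b (Sum.inl a) (Sum.inl b)
      + zmode Lc (fun κ u κ' u' => ((Lc : ℝ) ^ 8 * (Lc : ℝ) ^ (2 * (3 + 1))) • mmRead Lc (K3OfK (unitK (sfStep Lc (l + 1)) (smStep 3 Lc (l + 1)) (GcombSh (d := 3) Lc (l + 1))) Lc (unitS (sfStep Lc (l + 1)) (smStep 3 Lc (l + 1)) (SpureCombOf (symTablesAn1S2 3 Lc cΛ) ((Lc : ℝ) ^ 4) (-((Lc : ℝ) ^ 8 / 2)) cΛ (l + 1))) (unitM (sfStep Lc (l + 1)) (smStep 3 Lc (l + 1)) ((symTablesAn1S2 3 Lc cΛ).M (l + 1))) (W2SymOfK (unitK (sfStep Lc (l + 1)) (smStep 3 Lc (l + 1)) (GcombSh (d := 3) Lc (l + 1))) Lc (unitS (sfStep Lc (l + 1)) (smStep 3 Lc (l + 1)) (SpureCombOf (symTablesAn1S2 3 Lc cΛ) ((Lc : ℝ) ^ 4) (-((Lc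 : ℝ) ^ 8 / 2)) cΛ (l + 1))) (unitM (sfStep Lc (l + 1)) (smStep 3 Lc (l + 1)) ((symTablesAn1S2 3 Lc cΛ).M (l + 1))) 0 (unitM₂ (sfStep Lc (l + 1)) (smStep 3 Lc (l + 1)) (M2Of 3 Lc (symTablesAn1S2 3 Lc cΛ).mixFF (l + 1)))) κ u κ' u') + cB • (symTablesAn1S2 3 Lc cΛ).vh₂S κ u κ' u') b a (Sum.inl a) (Sum.inl b)
      + (zmode Lc (fun κ u κ' u' => ((Lc : ℝ) ^ 8 * (Lc : ℝ) ^ (2 * (3 + 1))) • mmRead Lc (K3OfK (unitK (sfStep Lc (l + 1)) (smStep 3 Lc (l + 1)) (GcombSh (d := 3) Lc (l + 1))) Lc (unitS (sfStep Lc (l + 1)) (smStep 3 Lc (l + 1)) (SpureCombOf (symTablesAn1S2 3 Lc cΛ) ((Lc : ℝ) ^ 4) (-((Lc : ℝ) ^ 8 / 2)) cΛ (l + 1))) (unitM (sfStep Lc (l + 1)) (smStep 3 Lc (l + 1)) ((symTablesAn1S2 3 Lc cΛ).M (l + 1))) (W2SymOfK (unitK (sfStep Lc (l + 1)) (smStep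 3 Lc (l + 1)) (GcombSh (d := 3) Lc (l + 1))) Lc (unitS (sfStep Lc (l + 1)) (smStep 3 Lc (l + 1)) (SpureCombOf (symTablesAn1S2 3 Lc cΛ) ((Lc : ℝ) ^ 4) (-((Lc : ℝ) ^ 8 / 2)) cΛ (l + 1))) (unitM (sfStep Lc (l + 1)) (smStep 3 Lc (l + 1)) ((symTablesAn1S2 3 Lc cΛ).M (l + 1))) 0 (unitM₂ (sfStep Lc (l + 1)) (smStep 3 Lc (l + 1)) (M2Of 3 Lc (symTablesAn1S2 3 Lc cΛ).mixFF (l + 1)))) κ u κ' u') + cB • (symTablesAn1S2 3 Lc cΛ).vh₂S κ u κ' u') a b (Sum.inl b) (Sum.inl a)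
      + zmode Lc (fun κ u κ' u' => ((Lc : ℝ) ^ 8 * (Lc : ℝ) ^ (2 * (3 + 1))) • mmRead Lc (K3OfK (unitK (sfStep Lc (l + 1)) (smStep 3 Lc (l + 1)) (GcombSh (d := 3) Lc (l + 1))) Lc (unitS (sfStep Lc (l + 1)) (smStep 3 Lc (l + 1)) (SpureCombOf (symTablesAn1S2 3 Lc cΛ) ((Lc : ℝ) ^ 4) (-((Lc : ℝ) ^ 8 / 2)) cΛ (l + 1))) (unitM (sfStep Lc (l + 1)) (smStep 3 Lc (l + 1)) ((symTablesAn1S2 3 Lc cΛ).M (l + 1))) (W2SymOfK (unitK (sfStep Lc (l + 1)) (smStep 3 Lc (l + 1)) (GcombSh (d := 3) Lc (l + 1))) Lc (unitS (sfStep Lc (l + 1)) (smStep 3 Lc (l + 1)) (SpureCombOf (symTablesAn1S2 3 Lc cΛ) ((Lc : ℝ) ^ 4) (-((Lc : ℝ) ^ 8 / 2)) cΛ (l + 1))) (unitM (sfStep Lc (l + 1)) (smStep 3 Lc (l + 1)) ((symTablesAn1S2 3 Lc cΛ).M (l + 1))) 0 (unitM₂ (sfStep Lc (l + 1)) (smStep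 3 Lc (l + 1)) (M2Of 3 Lc (symTablesAn1S2 3 Lc cΛ).mixFF (l + 1)))) κ u κ' u') + cB • (symTablesAn1S2 3 Lc cΛ).vh₂S κ u κ' u') b a (Sum.inl b) (Sum.inl a)))
        + ((Lc : ℝ) ^ 4 * ∑ r' ∈ box (3 + 1) Lc, ∑' u' : Site (3 + 1), ∑' x : Site (3 + 1), ∑' z : Site (3 + 1), (if toSite r' a % (Lc : ℤ) = (Lc : ℤ) - 1 ∧ u' b % (Lc : ℤ) = (Lc : ℤ) - 1 ∧ x a % (Lc : ℤ) = (Lc : ℤ) - 1 ∧ z b % (Lc : ℤ) = (Lc : ℤ) - 1 then unitS₂ (sfStep Lc (l + 1)) (smStep 3 Lc (l + 1)) (T2RecOf 3 Lc (GcombSh Lc) (SpureCombOf (symTablesAn1S2 3 Lc cΛ) ((Lc : ℝ) ^ 4) (-((Lc : ℝ) ^ 8 / 2)) cΛ) (symTablesAn1S2 3 Lc cΛ).M ((Lc : ℝ) ^ 8) cB ((8 * (N : ℝ) ^ 2)⁻¹ • wsym22 N) (symTablesAn1S2 3 Lc cΛ).vh₂S (symTablesAn1S2 3 Lc cΛ).mixFF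 (l + 1)) a (toSite r') b u' x z (Sum.inl a) (Sum.inl b) else 0) + (Lc : ℝ) ^ 4 * ∑ r' ∈ box (3 + 1) Lc, ∑' u' : Site (3 + 1), ∑' x : Site (3 + 1), ∑' z : Site (3 + 1), (if toSite r' b % (Lc : ℤ) = (Lc : ℤ) - 1 ∧ u' a % (Lc : ℤ) = (Lc : ℤ) - 1 ∧ x a % (Lc : ℤ) = (Lc : ℤ) - 1 ∧ z b % (Lc : ℤ) = (Lc : ℤ) - 1 then unitS₂ (sfStep Lc (l + 1)) (smStep 3 Lc (l + 1)) (T2RecOf 3 Lc (GcombSh Lc) (SpureCombOf (symTablesAn1S2 3 Lc cΛ) ((Lc : ℝ) ^ 4) (-((Lc : ℝ) ^ 8 / 2)) cΛ) (symTablesAn1S2 3 Lc cΛ).M ((Lc : ℝ) ^ 8) cB ((8 * (N : ℝ) ^ 2)⁻¹ • wsym22 N) (symTablesAn1S2 3 Lc cΛ).vh₂S (symTablesAn1S2 3 Lc cΛ).mixFF (l + 1)) b (toSite r') a u' x z (Sum.inl a) (Sum.inl b) else 0)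
      + ((Lc : ℝ) ^ 4 * ∑ r' ∈ box (3 + 1) Lc, ∑' u' : Site (3 + 1), ∑' x : Site (3 + 1), ∑' z : Site (3 + 1), (if toSite r' a % (Lc : ℤ) = (Lc : ℤ) - 1 ∧ u' b % (Lc : ℤ) = (Lc : ℤ) - 1 ∧ x b % (Lc : ℤ) = (Lc : ℤ) - 1 ∧ z a % (Lc : ℤ) = (Lc : ℤ) - 1 then unitS₂ (sfStep Lc (l + 1)) (smStep 3 Lc (l + 1)) (T2RecOf 3 Lc (GcombSh Lc) (SpureCombOf (symTablesAn1S2 3 Lc cΛ) ((Lc : ℝ) ^ 4) (-((Lc : ℝ) ^ 8 / 2)) cΛ) (symTablesAn1S2 3 Lc cΛ).M ((Lc : ℝ) ^ 8) cB ((8 * (N : ℝ) ^ 2)⁻¹ • wsym22 N) (symTablesAn1S2 3 Lc cΛ).vh₂S (symTablesAn1S2 3 Lc cΛ).mixFF (l + 1)) a (toSite r') b u' x z (Sum.inl b) (Sum.inl a) else 0) + (Lc : ℝ) ^ 4 * ∑ r' ∈ box (3 + 1) Lc, ∑' u' : Site (3 + 1), ∑' x : Site (3 + 1), ∑' z : Site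 (3 + 1), (if toSite r' b % (Lc : ℤ) = (Lc : ℤ) - 1 ∧ u' a % (Lc : ℤ) = (Lc : ℤ) - 1 ∧ x b % (Lc : ℤ) = (Lc : ℤ) - 1 ∧ z a % (Lc : ℤ) = (Lc : ℤ) - 1 then unitS₂ (sfStep Lc (l + 1)) (smStep 3 Lc (l + 1)) (T2RecOf 3 Lc (GcombSh Lc) (SpureCombOf (symTablesAn1S2 3 Lc cΛ) ((Lc : ℝ) ^ 4) (-((Lc : ℝ) ^ 8 / 2)) cΛ) (symTablesAn1S2 3 Lc cΛ).M ((Lc : ℝ) ^ 8) cB ((8 * (N : ℝ) ^ 2)⁻¹ • wsym22 N) (symTablesAn1S2 3 Lc cΛ).vh₂S (symTablesAn1S2 3 Lc cΛ).mixFF (l + 1)) b (toSite r') a u' x z (Sum.inl b) (Sum.inl a) else 0)))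
      = (zmode Lc (unitS₂ (sfStep Lc (l + 1)) (smStep 3 Lc (l + 1)) (T2RecOf 3 Lc (GcombSh Lc) (SpureCombOf (symTablesAn1S2 3 Lc cΛ) ((Lc : ℝ) ^ 4) (-((Lc : ℝ) ^ 8 / 2)) cΛ) (symTablesAn1S2 3 Lc cΛ).M ((Lc : ℝ) ^ 8) cB ((8 * (N : ℝ) ^ 2)⁻¹ • wsym22 N) (symTablesAn1S2 3 Lc cΛ).vh₂S (symTablesAn1S2 3 Lc cΛ).mixFF (l + 1))) a b (Sum.inl a) (Sum.inl b)
      + zmode Lc (unitS₂ (sfStep Lc (l + 1)) (smStep 3 Lc (l + 1)) (T2RecOf 3 Lc (GcombSh Lc) (SpureCombOf (symTablesAn1S2 3 Lc cΛ) ((Lc : ℝ) ^ 4) (-((Lc : ℝ) ^ 8 / 2)) cΛ) (symTablesAn1S2 3 Lc cΛ).M ((Lc : ℝ) ^ 8) cB ((8 * (N : ℝ) ^ 2)⁻¹ • wsym22 N) (symTablesAn1S2 3 Lc cΛ).vh₂S (symTablesAn1S2 3 Lc cΛ).mixFF (l + 1))) b a (Sum.inl a) (Sum.inl b)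
      + (zmode Lc (unitS₂ (sfStep Lc (l + 1)) (smStep 3 Lc (l + 1)) (T2RecOf 3 Lc (GcombSh Lc) (SpureCombOf (symTablesAn1S2 3 Lc cΛ) ((Lc : ℝ) ^ 4) (-((Lc : ℝ) ^ 8 / 2)) cΛ) (symTablesAn1S2 3 Lc cΛ).M ((Lc : ℝ) ^ 8) cB ((8 * (N : ℝ) ^ 2)⁻¹ • wsym22 N) (symTablesAn1S2 3 Lc cΛ).vh₂S (symTablesAn1S2 3 Lc cΛ).mixFF (l + 1))) a b (Sum.inl b) (Sum.inl a)
      + zmode Lc (unitS₂ (sfStep Lc (l + 1)) (smStep 3 Lc (l + 1)) (T2RecOf 3 Lc (GcombSh Lc) (SpureCombOf (symTablesAn1S2 3 Lc cΛ) ((Lc : ℝ) ^ 4) (-((Lc : ℝ) ^ 8 / 2)) cΛ) (symTablesAn1S2 3 Lc cΛ).M ((Lc : ℝ) ^ 8) cB ((8 * (N : ℝ) ^ 2)⁻¹ • wsym22 N) (symTablesAn1S2 3 Lc cΛ).vh₂S (symTablesAn1S2 3 Lc cΛ).mixFF (l + 1))) b a (Sum.inl b) (Sum.inl a))))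
    -- (iii) W-an2-1′: an2's QUARTIC REFLECTION LAW OF THE COMB-CHART MEMBER AT EVERY LEVEL, in comb letters (ASK an2; `SpineRecursiveT2AllComb` proves it from table letters)
    (γ : ℕ → ℝ)
    (h : ℕ → Fin 4 → Fin 4 → (Fin 4 → ℤ) → Fin 4 → (Fin 4 → ℤ) → (Fin 4 → ℤ) → Fib 3 → ℝ)
    (hhL : ∀ (j : ℕ) (α : Fin 4), ∃ C δ : ℝ, 0 < δ ∧ LocStencil₂ (fun κ u κ' u' => diagK (h j α κ u κ' u')) C δ)
    (hh : ∀ (j : ℕ) (α κ : Fin 4) (u : Fin 4 → ℤ) (κ' : Fin 4) (u' : Fin 4 → ℤ), ∃ s : Finset (Fin 4 → ℤ), ∀ x ∉ s, ∀ (β : Fin 4), h j α κ u κ' u' x (Sum.inl β) = 0)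
    (R2 : ℕ → Fin 4 → Fin 4 → (Fin 4 → ℤ) → Fin 4 → (Fin 4 → ℤ) → MKer 4 (Fib 3))
    (hR2c : ∀ (j : ℕ) (α : Fin 4), ∃ C δ : ℝ, 0 < δ ∧ LocStencil₂ (R2 j α) C δ)
    (hR2p : ∀ (j : ℕ) (α : Fin 4) κ u κ' u', trK (R2 j α κ u κ' u') = -sgnK (R2 j α κ u κ' u'))
    (hlaw : ∀ (j : ℕ) (α κ : Fin 4) (u : Fin 4 → ℤ) (κ' : Fin 4) (u' : Fin 4 → ℤ),
      T2RecOf 3 Lc (GcombSh Lc) (SpureCombOf (symTablesAn1S2 3 Lc cΛ) ((Lc : ℝ) ^ 4) (-((Lc : ℝ) ^ 8 / 2)) cΛ) (symTablesAn1S2 3 Lc cΛ).M ((Lc : ℝ) ^ 8) cB ((8 * (N : ℝ) ^ 2)⁻¹ • wsym22 N)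
          (symTablesAn1S2 3 Lc cΛ).vh₂S (symTablesAn1S2 3 Lc cΛ).mixFF j κ (bref α κ u) κ' (bref α κ' u') =
        (reflSign α κ * reflSign α κ') • refK (Φ Lc α)
          (T2RecOf 3 Lc (GcombSh Lc) (SpureCombOf (symTablesAn1S2 3 Lc cΛ) ((Lc : ℝ) ^ 4) (-((Lc : ℝ) ^ 8 / 2)) cΛ) (symTablesAn1S2 3 Lc cΛ).M ((Lc : ℝ) ^ 8) cB ((8 * (N : ℝ) ^ 2)⁻¹ • wsym22 N)
              (symTablesAn1S2 3 Lc cΛ).vh₂S (symTablesAn1S2 3 Lc cΛ).mixFF j κ u κ' u' +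
            conjW (bhKStepSh 3 Lc (Dsh Lc) j)
              (SpureCombOf (symTablesAn1S2 3 Lc cΛ) ((Lc : ℝ) ^ 4) (-((Lc : ℝ) ^ 8 / 2)) cΛ j κ u)
              (SpureCombOf (symTablesAn1S2 3 Lc cΛ) ((Lc : ℝ) ^ 4) (-((Lc : ℝ) ^ 8 / 2)) cΛ j κ' u')
              (diagK fun p a => γ j * ctGenM 3 (bhK Lc + Dsh Lc) α Lc κ u p a) (diagK fun p a => γ j * ctGenM 3 (bhK Lc + Dsh Lc) α Lc κ' u' p a)
              (diagK (h j α κ u κ' u')) +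
            R2 j α κ u κ' u'))
    (μ ν : Fin 4) (Nc : ℝ) :
    D1Drift Lc (JsB12CombShSym hLc N (symTablesAn1S2 3 Lc cΛ) cΛ cB) Nc μ ν ↔
      RateCertificate.CauchyRate.lim (fun j => B12Beta.secondMoment (TbalOf Lc (JsB12CombShSym hLc N (symTablesAn1S2 3 Lc cΛ) cΛ cB) j) μ ν) =
        B12Normalization.stepBal Nc Lc :=
  d1Drift_JsB12CombShSym_an1_iff_lim_eq_of_sRows_pairFormSucc_forcingCrossedSucc_law hLc hLc2 hN hΛ hcB hS hSall hδS hθS0 hθS1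
    (fun i => pairFormLS_combForcing_succ_an1_of_pairForm cΛ cB i (hZs i) (hRs i)) hXFs γ h hhL hh R2 hR2c hR2p hlaw μ ν Nc

end Summit.QuantumFields.BalabanUV.Beta.GAN24.CombChargeLevelSuccRowsOfCellTotals

end
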